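import Summits.HodgeConjecture.HodgeConjecture.Theorems.F0P3cStCharTSTransferVanish      -- ★ p849275 (this seat): relation-level transfer lemmas (imports `LocalTransfer`)
import Literature.NumberTheory.Automorphic.DoubleCosetHaarVolume                          -- ★ `DoubleCosetIndex.isCompact_doubleCoset`
import HarnessLib

/-!
# F0 · P3c · line LH6 «StCharTS» — road (D) «DEEP-FL», brick (D-c)-glue «SCALARS AND SUPPORTS OF THE SHELL PAIR»: `Φ`, `Φ^st` and ★ `IsDeltaTransferRel` ∕ ★ `IsLocalDeltaTransfer`
# are homogeneous in the test functions, and `tsupport (c • 𝟙_{K b K}) ⊆ K b K`, `(tsupport (c • 𝟙_{S₂ ×ˢ S₁})).1 ⊆ S₂` — the `hf` ∕ `hfH` inputs of ★ `isLocalDeltaTransfer_of_levi` for `f^H₀ = c_b • 𝟙`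

Cell `pub/hodgecm-mathlib`, crux H413 = `stmt-HodgeConjecture-24833` (`--supports` lane, helper), route HCCMUnconditional; seat LH6-p04 (g2), road (D) owner; status v4
`F0/P3b/LH6-p04/g2/ROAD-D.status.v4.txt` ((D-c) assembly glue).  THEOREMS ONLY, sorry-free.  HONEST LABEL: HC_CM is proved only modulo the 7 printed citations (2 remaining:
hLiu418 = stmt-HodgeConjecture-24832, h413 = stmt-HodgeConjecture-24833) until rung 0 closes; count-neutral.
[Rogawski1990, §4.3 (4.3.1) p. 43; §4.9 p. 54.]

## References
* [Rogawski1990] J. D. Rogawski, *Automorphic Representations of Unitary Groups in Three Variables*, Ann. of Math. Stud. 123 (1990), §4.3 p. 43; §4.9 p. 54.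
* [CartierCorvallis1979] P. Cartier, *Representations of p-adic groups: a survey*, Proc. Sympos. Pure Math. 33 (1979), §IV.1.
-/

set_option autoImplicit false
-- the mandated namespace has the single-problem summit's repeated segment (`HodgeConjecture.HodgeConjecture`)
set_option linter.dupNamespace false

noncomputable section

open MeasureTheory NumberField IsDedekindDomain
open scoped MatrixGroups
open Literature.NumberTheory.Rogawski1990 Literature.NumberTheory.Automorphic Literature.NumberTheory.Automorphic.UnitaryGroup

namespace Summit.HodgeConjecture.HodgeConjecture.Cruxes.H413.F0P3cStCharTSShellPairGlue

/-! ## §1 Supports of scalar multiples of indicators -/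

section Support

variable {X : Type*} [TopologicalSpace X]

/-- `tsupport (c • f) ⊆ tsupport f`. [folklore] -/
theorem tsupport_const_smul_subset (c : ℂ) (f : X → ℂ) : tsupport (c • f) ⊆ tsupport f := by
  refine closure_mono fun x hx => ?_
  rw [Function.mem_support] at hx ⊢
  intro h0
  exact hx (by rw [Pi.smul_apply, h0, smul_zero])

/-- For CLOSED `S`: `tsupport (S.indicator g) ⊆ S`. [folklore] -/
theorem tsupport_indicator_subset_of_isClosed {S : Set X} (hS : IsClosed S) (g : X → ℂ) : tsupport (S.indicator g) ⊆ S :=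
  closure_minimal Set.support_indicator_subset hS

/-- For CLOSED `S`: `tsupport (c • S.indicator g) ⊆ S`. [folklore] -/
theorem tsupport_const_smul_indicator_subset_of_isClosed {S : Set X} (hS : IsClosed S) (c : ℂ) (g : X → ℂ) : tsupport (c • S.indicator g) ⊆ S :=
  (tsupport_const_smul_subset c _).trans (tsupport_indicator_subset_of_isClosed hS g)

/-- In a Hausdorff topological group the double coset `K b K` of a COMPACT subgroup is closed, so `tsupport (c • 𝟙_{K b K}) ⊆ K b K`. [cite: CartierCorvallis1979, §IV.1] -/
theorem tsupport_const_smul_indicator_doubleCoset_subset {G : Type*} [Group G] [TopologicalSpace G] [IsTopologicalGroup G] [T2Space G]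
    {K : Subgroup G} (hKc : IsCompact (K : Set G)) (b : G) (c : ℂ) (g : G → ℂ) :
    tsupport (c • (DoubleCoset.doubleCoset b (K : Set G) K).indicator g) ⊆ DoubleCoset.doubleCoset b (K : Set G) K :=
  tsupport_const_smul_indicator_subset_of_isClosed (DoubleCosetIndex.isCompact_doubleCoset hKc b).isClosed c g

/-- Product version for `H = A × B`: `tsupport (c • (S₂ ×ˢ S₁).indicator g)` has first components in `S₂` when `S₂, S₁` are closed. [folklore] -/
theorem fst_mem_of_mem_tsupport_const_smul_indicator_prod {A B : Type*} [TopologicalSpace A] [TopologicalSpace B] {S₂ : Set A} {S₁ : Set B}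
    (hS₂ : IsClosed S₂) (hS₁ : IsClosed S₁) (c : ℂ) (g : A × B → ℂ) (x : A × B) (hx : x ∈ tsupport (c • (S₂ ×ˢ S₁).indicator g)) : x.1 ∈ S₂ :=
  (Set.mem_prod.1 (tsupport_const_smul_indicator_subset_of_isClosed (hS₂.prod hS₁) c g hx)).1

end Support

/-! ## §2 Homogeneity of `Φ`, `Φ^st` and of the transfer relation -/

section Smul

variable {A B : Type*} [Group A] [Group B]
  [∀ a : A, MeasurableSpace (A ⧸ Subgroup.centralizer ({a} : Set A))]
  [∀ b : B, MeasurableSpace (B ⧸ Subgroup.centralizer ({b} : Set B))]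

/-- `Φ(c, r • f) = r · Φ(c, f)`. [cite: Rogawski1990, §4.9 p. 54] -/
theorem classOrbitalIntegral_const_smul (m : OrbitalMeasureFamily B) (r : ℂ) (f : B → ℂ) (c : ConjClasses B) :
    classOrbitalIntegral m (r • f) c = r * classOrbitalIntegral m f c := by
  rw [classOrbitalIntegral_eq, classOrbitalIntegral_eq, orbitalIntegral_smul, smul_eq_mul]

/-- `Φ^st(a, r • f^H) = r · Φ^st(a, f^H)`. [cite: Rogawski1990, §4.1 (4.1.1) p. 39] -/
theorem stableOrbitalIntegralRel_const_smul (stA : A → A → Prop) (mH : OrbitalMeasureFamily A) (r : ℂ) (fH : A → ℂ) (a : A) :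
    stableOrbitalIntegralRel stA mH (r • fH) a = r * stableOrbitalIntegralRel stA mH fH a := by
  rw [stableOrbitalIntegralRel_def, stableOrbitalIntegralRel_def, mul_finsum_mem]
  exact finsum_congr fun c => finsum_congr fun _ => classOrbitalIntegral_const_smul mH r fH c

/-- **The transfer relation is homogeneous**: if `f^H` is a `Δ`-transfer of `f` then `r • f^H` is a `Δ`-transfer of `r • f`. [cite: Rogawski1990, §4.3 (4.3.1) p. 43] -/
theorem isDeltaTransferRel_const_smul {R : A → B → Prop} (stA : A → A → Prop) (regA : A → Prop) (T : TransferFactorData A B R)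
    (mH : OrbitalMeasureFamily A) (mG : OrbitalMeasureFamily B) {fH : A → ℂ} {f : B → ℂ} (h : IsDeltaTransferRel R stA regA T mH mG fH f) (r : ℂ) :
    IsDeltaTransferRel R stA regA T mH mG (r • fH) (r • f) := by
  intro a ha
  rw [stableOrbitalIntegralRel_const_smul, h a ha, mul_finsum]
  exact finsum_congr fun c => by rw [classOrbitalIntegral_const_smul]; ring

end Smul

/-! ## §3 On the CM carriers -/

section CM

variable (L : Type) [Field L] [NumberField L] [IsCMField L] (v : HeightOneSpectrum (𝓞 ↥(maximalRealSubfield L)))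

set_option maxHeartbeats 800000 in  -- statement-level `whnf` on the CM carriers
/-- **★ `IsLocalDeltaTransfer` is homogeneous** (any hermitian `H′`, any transfer factor). [cite: Rogawski1990, §4.3 (4.3.1) p. 43] -/
theorem isLocalDeltaTransfer_const_smul (H' : Matrix (Fin 3) (Fin 3) L)
    [∀ γ : (cmDatum L 3 H').Local v, MeasurableSpace ((cmDatum L 3 H').Local v ⧸ Subgroup.centralizer ({γ} : Set ((cmDatum L 3 H').Local v)))]
    [∀ aH : ((cmDatum L 2 (Matrix.of fun i j : Fin 2 => if i.val + j.val + 1 = 2 then (1 : L) else 0)).Local v × (cmDatum L 1 (Matrix.of fun i j : Fin 1 => if i.val + j.val + 1 = 1 then (1 : L) else 0)).Local v),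
      MeasurableSpace (((cmDatum L 2 (Matrix.of fun i j : Fin 2 => if i.val + j.val + 1 = 2 then (1 : L) else 0)).Local v × (cmDatum L 1 (Matrix.of fun i j : Fin 1 => if i.val + j.val + 1 = 1 then (1 : L) else 0)).Local v) ⧸
        Subgroup.centralizer ({aH} : Set ((cmDatum L 2 (Matrix.of fun i j : Fin 2 => if i.val + j.val + 1 = 2 then (1 : L) else 0)).Local v × (cmDatum L 1 (Matrix.of fun i j : Fin 1 => if i.val + j.val + 1 = 1 then (1 : L) else 0)).Local v)))]
    (T : LocalTransferFactor L H' v)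
    (mH : OrbitalMeasureFamily ((cmDatum L 2 (Matrix.of fun i j : Fin 2 => if i.val + j.val + 1 = 2 then (1 : L) else 0)).Local v ×
      (cmDatum L 1 (Matrix.of fun i j : Fin 1 => if i.val + j.val + 1 = 1 then (1 : L) else 0)).Local v))
    (mG : OrbitalMeasureFamily ((cmDatum L 3 H').Local v))
    {fH : ((cmDatum L 2 (Matrix.of fun i j : Fin 2 => if i.val + j.val + 1 = 2 then (1 : L) else 0)).Local v ×
      (cmDatum L 1 (Matrix.of fun i j : Fin 1 => if i.val + j.val + 1 = 1 then (1 : L) else 0)).Local v) → ℂ} {f : (cmDatum L 3 H').Local v → ℂ}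
    (h : IsLocalDeltaTransfer L H' v T mH mG fH f) (r : ℂ) :
    IsLocalDeltaTransfer L H' v T mH mG (r • fH) (r • f) :=
  isDeltaTransferRel_const_smul (IsLocalStablyConjH L v) (IsLocalGRegular L v) T mH mG h r

end CM

end Summit.HodgeConjecture.HodgeConjecture.Cruxes.H413.F0P3cStCharTSShellPairGlue
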